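import Mathlib
import Literature.NumberTheory.LFunctions.Zhang2022.SkeletonPartTwo
import HarnessLib

/-!
# Zhang (2022) §8 pp. 48–49: the shift-perturbation calculus behind `𝔣_{jμ}(Pᶻ) = 𝔣𝔣_{jμ}(z) + O(𝓛⁻⁸)`,
# `𝔤_{jμ}(Pᶻ) = 𝔤𝔥_{jμ}(z) + O(𝓛⁻⁸)` (DAG nodes `Z22:§8.u049`, `Z22:§8.u050`; part 1 of 2)

Topic `Literature/NumberTheory/LFunctions/Zhang2022` (Landau–Siegel audit tree; verdict-neutral).
Y. Zhang, *Discrete mean estimates and the Landau–Siegel zero*, arXiv:2211.02515v1 (2022)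
[Zhang2022LandauSiegel] — **an unrefereed manuscript under adjudication** (D-0069 width campaign,
layer L2, discharge seat sz-d19). The manuscript writes (p. 48 last line – p. 49, tex L2480–L2504)
"By direct calculation, for `0 ≤ z ≤ 1` we have `𝔣_{jμ}(Pᶻ) = 𝔣𝔣_{jμ}(z) + O(𝓛⁻⁸)`,
`𝔤_{jμ}(Pᶻ) = 𝔤𝔥_{jμ}(z) + O(𝓛⁻⁸)`" (`μ = 6, 7`). At the MAIN VALUES `β_j⁰ = jiα` of the shifts the
identities are EXACT (tree `frakf_main_*`, `frakg_main_*`, `Section8MainTerms`, via `α log P = π`);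
this file supplies the perturbation step from the main values to the skeleton's TRUE shifts
`β_j = β_j(c′)` of (2.13) (`Skeleton.beta1/2/3`, `Skeleton.betaJ`, `Skeleton.betaMu`):

* `𝔣` is affine in `β_j`, `‖𝔣(β) − 𝔣(β′)‖ = ‖β − β′‖·|L|` (`norm_frakf_sub_frakf`); the `𝔤`-difference
  is bounded by `frakg_perturbation_bound` (`‖β_μ‖ ∈ [3α/2, 3α]`, `α|L| ≤ π`);
* `‖β_k − β_k⁰‖ ≤ 5|c′|α²𝓛 = wα` for `k = 1, 2, 3`, `w = 5|c′|α𝓛 = 5|c′|π𝓛⁻⁸` ((2.13), (2.10) `α𝓛⁹ = π`,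
  (2.6) `log P = 𝓛⁹`), `β₆ = β⁰_{3/2}`, `β₇ = β⁰_{5/2}` exactly ((2.22));
* hence at `x = Pᶻ`, `0 ≤ z ≤ 1`, `D ≥ 3`: `‖𝔣(β,β_μ) − 𝔣(β_k⁰,β_μ)‖ ≤ 5|c′|π²·𝓛⁻⁸`
  (`frakf_rpow_estimate`) and `‖𝔤(β₁,β₂,β_μ) − 𝔤(β⁰,β⁰,β_μ)‖ ≤ (70|c′|π² + 40c′²π³)·𝓛⁻⁸`
  (`frakg_rpow_estimate`) — EXPLICIT constants, every `D ≥ 3`.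

Part 2 (`Section8ProfilesAtPz`) specialises these to the twelve printed pairs (8.13)–(8.18) and to the
shape of the typed claims `Section8dStatements.Step8u049/050`. WHAT THIS FILE IS NOT: anything about
(8.11)–(8.12), (8.23)–(8.24), or Theorems 1–2 / Landau–Siegel zeros. No definitions, no new facts.

## References

* Y. Zhang, arXiv:2211.02515v1 (2022), §8 pp. 48–49 (tex L2480–L2504); §2 (2.6), (2.10), (2.13),
  (2.22); Lemmas 8.2, 8.4 (the profiles `𝔣_{jμ}`, `𝔤_{jμ}`). [cite: Zhang2022LandauSiegel, §8 pp.48–49]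
-/

noncomputable section

open Complex Real

namespace Literature.NumberTheory.LFunctions.Zhang2022.Section8ShiftPerturbation

open Skeleton

/-! ## Generic perturbation of the two profiles in the shifts -/

/-- `𝔣` is affine in `β_j`: `𝔣(β_j) − 𝔣(β_j′) = −(β_j − β_j′)·L·e^{β_μ L}`.
[cite: Zhang2022LandauSiegel, §8 Lemma 8.2] -/
theorem frakf_sub_frakf (βj βj' βμ L : ℂ) :
    frakf βj βμ L - frakf βj' βμ L = -((βj - βj') * L * cexp (βμ * L)) := by
  unfold frakf; ring

/-- The difference of two `𝔤`'s with the same `β_μ`, split into its `β_μ⁻²` and `β_μ⁻¹L` parts.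
[cite: Zhang2022LandauSiegel, §8 Lemma 8.4] -/
theorem frakg_sub_frakg (β1 β2 β1' β2' βμ L : ℂ) :
    frakg β1 β2 βμ L - frakg β1' β2' βμ L =
      (β1 * β2 - β1' * β2') / βμ ^ 2 * (1 - cexp (-(βμ * L))) -
        ((β1 - βμ) * (β2 - βμ) - (β1' - βμ) * (β2' - βμ)) / βμ * L * cexp (-(βμ * L)) := by
  unfold frakg; ring

/-- `|e^{βL}| = 1` for a main-value (purely imaginary) shift `β = μiα` and real `L`.
[cite: Zhang2022LandauSiegel, §2 (2.22)] -/
theorem norm_cexp_betaMain_mul (μ : ℚ) (α L : ℝ) : ‖cexp (betaMain μ α * L)‖ = 1 := by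
  have h : betaMain μ α * (L : ℂ) = (((μ : ℝ) * α * L : ℝ) : ℂ) * I := by
    unfold betaMain; push_cast; ring
  rw [h, Complex.norm_exp_ofReal_mul_I]

/-- `|e^{−βL}| = 1` for `β = μiα`, `L` real. [cite: Zhang2022LandauSiegel, §2 (2.22)] -/
theorem norm_cexp_neg_betaMain_mul (μ : ℚ) (α L : ℝ) : ‖cexp (-(betaMain μ α * L))‖ = 1 := by
  have h : -(betaMain μ α * (L : ℂ)) = ((-((μ : ℝ) * α * L) : ℝ) : ℂ) * I := by
    unfold betaMain; push_cast; ring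
  rw [h, Complex.norm_exp_ofReal_mul_I]

/-- `‖𝔣(β_j) − 𝔣(β_j′)‖ = ‖β_j − β_j′‖·|L|` (`β_μ` a main value, `L` real).
[cite: Zhang2022LandauSiegel, §8 Lemma 8.2] -/
theorem norm_frakf_sub_frakf (βj βj' : ℂ) (μ : ℚ) (α L : ℝ) :
    ‖frakf βj (betaMain μ α) L - frakf βj' (betaMain μ α) L‖ = ‖βj - βj'‖ * |L| := by
  rw [frakf_sub_frakf, norm_neg, norm_mul, norm_mul, norm_cexp_betaMain_mul, mul_one,
    Complex.norm_real, Real.norm_eq_abs]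

/-- `‖𝔤(β₁,β₂) − 𝔤(β₁′,β₂′)‖ ≤ 2‖β₁β₂ − β₁′β₂′‖/‖β_μ‖² + ‖(β₁−β_μ)(β₂−β_μ) − (β₁′−β_μ)(β₂′−β_μ)‖/‖β_μ‖·|L|`
(`β_μ` a main value, `L` real). [cite: Zhang2022LandauSiegel, §8 Lemma 8.4] -/
theorem norm_frakg_sub_frakg_le (β1 β2 β1' β2' : ℂ) (μ : ℚ) (α L : ℝ) :
    ‖frakg β1 β2 (betaMain μ α) L - frakg β1' β2' (betaMain μ α) L‖ ≤
      2 * (‖β1 * β2 - β1' * β2'‖ / ‖betaMain μ α‖ ^ 2) +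
        ‖(β1 - betaMain μ α) * (β2 - betaMain μ α) -
            (β1' - betaMain μ α) * (β2' - betaMain μ α)‖ / ‖betaMain μ α‖ * |L| := by
  rw [frakg_sub_frakg]
  refine (norm_sub_le _ _).trans (add_le_add ?_ ?_)
  · rw [norm_mul, norm_div, norm_pow]
    have h2 : ‖1 - cexp (-(betaMain μ α * L))‖ ≤ 2 := by
      calc ‖1 - cexp (-(betaMain μ α * L))‖
          ≤ ‖(1 : ℂ)‖ + ‖cexp (-(betaMain μ α * L))‖ := norm_sub_le _ _
        _ = 2 := by rw [norm_one, norm_cexp_neg_betaMain_mul]; norm_num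
    calc ‖β1 * β2 - β1' * β2'‖ / ‖betaMain μ α‖ ^ 2 * ‖1 - cexp (-(betaMain μ α * ↑L))‖
        ≤ ‖β1 * β2 - β1' * β2'‖ / ‖betaMain μ α‖ ^ 2 * 2 := by gcongr
      _ = _ := by ring
  · rw [norm_mul, norm_mul, norm_div, norm_cexp_neg_betaMain_mul, mul_one, Complex.norm_real,
      Real.norm_eq_abs]

/-- `‖β₁β₂ − β₁′β₂′‖ ≤ ‖β₁ − β₁′‖‖β₂‖ + ‖β₁′‖‖β₂ − β₂′‖` (private helper). [folklore] -/
private theorem norm_mul_sub_mul_le' (β1 β2 β1' β2' : ℂ) :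
    ‖β1 * β2 - β1' * β2'‖ ≤ ‖β1 - β1'‖ * ‖β2‖ + ‖β1'‖ * ‖β2 - β2'‖ := by
  have h : β1 * β2 - β1' * β2' = (β1 - β1') * β2 + β1' * (β2 - β2') := by ring
  rw [h]
  exact (norm_add_le _ _).trans (by rw [norm_mul, norm_mul])

/-- The abstract shift-perturbation bound behind `𝔤_{jμ}(Pᶻ) = 𝔤𝔥_{jμ}(z) + O(𝓛⁻⁸)`: shifts within
`wα` of main values of norm `≤ 3α`, `‖β_μ‖ ∈ [3α/2, 3α]`, `α|L| ≤ π` ⇒ the right side of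
`norm_frakg_sub_frakg_le` is `≤ (8/9)(6w + w²) + (2π/3)(12w + w²)`.
[cite: Zhang2022LandauSiegel, §8 p.49] -/
theorem frakg_perturbation_bound {α w L : ℝ} {β1 β2 β1' β2' m : ℂ} (hα : 0 < α) (hw : 0 ≤ w)
    (h1 : ‖β1 - β1'‖ ≤ w * α) (h2 : ‖β2 - β2'‖ ≤ w * α) (h1' : ‖β1'‖ ≤ 3 * α)
    (h2' : ‖β2'‖ ≤ 3 * α) (hm : 3 / 2 * α ≤ ‖m‖) (hm' : ‖m‖ ≤ 3 * α) (hL : α * |L| ≤ π) :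
    2 * (‖β1 * β2 - β1' * β2'‖ / ‖m‖ ^ 2) +
        ‖(β1 - m) * (β2 - m) - (β1' - m) * (β2' - m)‖ / ‖m‖ * |L| ≤
      8 / 9 * (6 * w + w ^ 2) + 2 * π / 3 * (12 * w + w ^ 2) := by
  have hm0 : 0 < ‖m‖ := lt_of_lt_of_le (by positivity) hm
  have hb2 : ‖β2‖ ≤ 3 * α + w * α := by
    calc ‖β2‖ = ‖β2' + (β2 - β2')‖ := by ring_nf
      _ ≤ ‖β2'‖ + ‖β2 - β2'‖ := norm_add_le _ _
      _ ≤ 3 * α + w * α := add_le_add h2' h2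
  have hT1 : ‖β1 * β2 - β1' * β2'‖ / ‖m‖ ^ 2 ≤ 4 / 9 * (6 * w + w ^ 2) := by
    rw [div_le_iff₀ (by positivity)]
    calc ‖β1 * β2 - β1' * β2'‖ ≤ ‖β1 - β1'‖ * ‖β2‖ + ‖β1'‖ * ‖β2 - β2'‖ :=
          norm_mul_sub_mul_le' _ _ _ _
      _ ≤ w * α * (3 * α + w * α) + 3 * α * (w * α) := by gcongr
      _ = 4 / 9 * (6 * w + w ^ 2) * (3 / 2 * α) ^ 2 := by ring
      _ ≤ 4 / 9 * (6 * w + w ^ 2) * ‖m‖ ^ 2 := by gcongr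
  have hdiv : ‖(β1 - m) * (β2 - m) - (β1' - m) * (β2' - m)‖ / ‖m‖ ≤
      2 / 3 * α * (12 * w + w ^ 2) := by
    rw [div_le_iff₀ hm0]
    calc ‖(β1 - m) * (β2 - m) - (β1' - m) * (β2' - m)‖
        ≤ ‖(β1 - m) - (β1' - m)‖ * ‖β2 - m‖ + ‖β1' - m‖ * ‖(β2 - m) - (β2' - m)‖ :=
          norm_mul_sub_mul_le' _ _ _ _
      _ = ‖β1 - β1'‖ * ‖β2 - m‖ + ‖β1' - m‖ * ‖β2 - β2'‖ := by ring_nf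
      _ ≤ ‖β1 - β1'‖ * (‖β2‖ + ‖m‖) + (‖β1'‖ + ‖m‖) * ‖β2 - β2'‖ := by
          gcongr
          · exact norm_sub_le _ _
          · exact norm_sub_le _ _
      _ ≤ w * α * (3 * α + w * α + 3 * α) + (3 * α + 3 * α) * (w * α) := by gcongr
      _ = 2 / 3 * α * (12 * w + w ^ 2) * (3 / 2 * α) := by ring
      _ ≤ 2 / 3 * α * (12 * w + w ^ 2) * ‖m‖ := by gcongr
  have hT2 : ‖(β1 - m) * (β2 - m) - (β1' - m) * (β2' - m)‖ / ‖m‖ * |L| ≤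
      2 * π / 3 * (12 * w + w ^ 2) := by
    calc ‖(β1 - m) * (β2 - m) - (β1' - m) * (β2' - m)‖ / ‖m‖ * |L|
        ≤ 2 / 3 * α * (12 * w + w ^ 2) * |L| := by gcongr
      _ = 2 / 3 * (12 * w + w ^ 2) * (α * |L|) := by ring
      _ ≤ 2 / 3 * (12 * w + w ^ 2) * π := by gcongr
      _ = 2 * π / 3 * (12 * w + w ^ 2) := by ring
  linarith

/-! ## The skeleton's parameters: `log Pᶻ = z𝓛⁹`, `α𝓛⁹ = π`, the shifts against their main values -/

section Params

variable (c' : ℝ) (D : ℕ)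

/-- `𝓛 > 1` for `D ≥ 3`. [cite: Zhang2022LandauSiegel, §2 (2.1)] -/
theorem one_lt_ell' {D : ℕ} (hD : 3 ≤ D) : 1 < ell D := by
  have hD' : (3 : ℝ) ≤ D := by exact_mod_cast hD
  have h : (1 : ℝ) < Real.log 3 := by
    rw [Real.lt_log_iff_exp_lt (by norm_num)]
    exact Real.exp_one_lt_d9.trans (by norm_num)
  exact lt_of_lt_of_le h (Real.log_le_log (by norm_num) hD')

/-- `log(Pᶻ) = z·𝓛⁹`, cast to `ℂ` ((2.6) `P = exp 𝓛⁹`). [cite: Zhang2022LandauSiegel, §2 (2.6)] -/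
theorem ofReal_log_bigP_rpow (z : ℝ) :
    ((Real.log (bigP D ^ z) : ℝ) : ℂ) = (z : ℂ) * ((ell D ^ 9 : ℝ) : ℂ) := by
  have hP : 0 < bigP D := Real.exp_pos _
  rw [Real.log_rpow hP, bigP, Real.log_exp, Complex.ofReal_mul]

/-- `α = π/𝓛⁹` ((2.10) with (2.6)). [cite: Zhang2022LandauSiegel, §2 (2.10)] -/
theorem alpha_eq_div : alpha D = π / ell D ^ 9 := by rw [alpha, bigP, Real.log_exp]

/-- `α > 0` for `D ≥ 3`. [cite: Zhang2022LandauSiegel, §2 (2.10)] -/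
theorem alpha_pos' {D : ℕ} (hD : 3 ≤ D) : 0 < alpha D := by
  rw [alpha_eq_div]; exact div_pos Real.pi_pos (pow_pos (by linarith [one_lt_ell' hD]) _)

/-- `α·𝓛⁹ = π`, i.e. `α log P = π` (`D ≥ 3`). [cite: Zhang2022LandauSiegel, §2 (2.10)] -/
theorem alpha_mul_ell_pow_nine {D : ℕ} (hD : 3 ≤ D) : alpha D * ell D ^ 9 = π := by
  have hℓ : ell D ^ 9 ≠ 0 := pow_ne_zero _ (by linarith [one_lt_ell' hD])
  rw [alpha_eq_div, div_mul_cancel₀ _ hℓ]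

/-- `α·𝓛 = π·(𝓛⁸)⁻¹` (`D ≥ 3`). [cite: Zhang2022LandauSiegel, §2 (2.10)] -/
theorem alpha_mul_ell {D : ℕ} (hD : 3 ≤ D) : alpha D * ell D = π * (ell D ^ 8)⁻¹ := by
  have hℓ : ell D ≠ 0 := by linarith [one_lt_ell' hD]
  have h9 : ell D ^ 9 = ell D ^ 8 * ell D := pow_succ _ _
  rw [alpha_eq_div, h9, div_mul_eq_mul_div, mul_div_mul_right _ _ hℓ, div_eq_mul_inv]

/-- `β₆ = (3/2)iα` is the main value `betaMain (3/2) α`. [cite: Zhang2022LandauSiegel, §2 (2.22)] -/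
theorem betaMu_six : betaMu D 6 = betaMain (3 / 2) (alpha D) := by
  simp only [betaMu, show (6 : ℕ) ≠ 7 by decide, if_false, beta6, betaMain]
  push_cast; ring

/-- `β₇ = (5/2)iα` is the main value `betaMain (5/2) α`. [cite: Zhang2022LandauSiegel, §2 (2.22)] -/
theorem betaMu_seven : betaMu D 7 = betaMain (5 / 2) (alpha D) := by
  simp only [betaMu, if_true, beta7, betaMain]
  push_cast; ring

/-- `‖β₁ − β₁⁰‖ ≤ wα`, `w = 5|c′|α𝓛` (`β₁ − β₁⁰ = −5ic′α²𝓛`, (2.13)). [cite: Zhang2022LandauSiegel, §2 (2.13)] -/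
theorem norm_beta1_sub_main_le {D : ℕ} (hD : 3 ≤ D) :
    ‖beta1 c' D - betaMain 1 (alpha D)‖ ≤ 5 * |c'| * alpha D * ell D * alpha D := by
  have hα : 0 ≤ alpha D := (alpha_pos' hD).le
  have hℓ : 0 ≤ ell D := by linarith [one_lt_ell' hD]
  have h : beta1 c' D - betaMain 1 (alpha D) = ((-(5 * c' * alpha D ^ 2 * ell D) : ℝ) : ℂ) * I := by
    unfold beta1 betaMain; push_cast; ring
  rw [h, norm_mul, Complex.norm_I, mul_one, Complex.norm_real, Real.norm_eq_abs, abs_neg, abs_mul,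
    abs_mul, abs_mul, abs_of_nonneg hℓ, abs_of_nonneg (sq_nonneg (alpha D)),
    abs_of_nonneg (by norm_num : (0:ℝ) ≤ 5)]
  have h0 : 0 ≤ |c'| * alpha D ^ 2 * ell D := by positivity
  nlinarith

/-- `‖β₂ − β₂⁰‖ ≤ wα` (`β₂ − β₂⁰ = 2ic′α²𝓛`, (2.13)). [cite: Zhang2022LandauSiegel, §2 (2.13)] -/
theorem norm_beta2_sub_main_le {D : ℕ} (hD : 3 ≤ D) :
    ‖beta2 c' D - betaMain 2 (alpha D)‖ ≤ 5 * |c'| * alpha D * ell D * alpha D := by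
  have hα : 0 ≤ alpha D := (alpha_pos' hD).le
  have hℓ : 0 ≤ ell D := by linarith [one_lt_ell' hD]
  have h : beta2 c' D - betaMain 2 (alpha D) = ((2 * c' * alpha D ^ 2 * ell D : ℝ) : ℂ) * I := by
    unfold beta2 betaMain; push_cast; ring
  rw [h, norm_mul, Complex.norm_I, mul_one, Complex.norm_real, Real.norm_eq_abs, abs_mul, abs_mul,
    abs_mul, abs_of_nonneg hℓ, abs_of_nonneg (sq_nonneg (alpha D)),
    abs_of_nonneg (by norm_num : (0:ℝ) ≤ 2)]
  have h0 : 0 ≤ |c'| * alpha D ^ 2 * ell D := by positivity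
  nlinarith

/-- `‖β₃ − β₃⁰‖ ≤ wα` (`β₃ − β₃⁰ = −3ic′α²𝓛`, (2.13)). [cite: Zhang2022LandauSiegel, §2 (2.13)] -/
theorem norm_beta3_sub_main_le {D : ℕ} (hD : 3 ≤ D) :
    ‖beta3 c' D - betaMain 3 (alpha D)‖ ≤ 5 * |c'| * alpha D * ell D * alpha D := by
  have hα : 0 ≤ alpha D := (alpha_pos' hD).le
  have hℓ : 0 ≤ ell D := by linarith [one_lt_ell' hD]
  have h : beta3 c' D - betaMain 3 (alpha D) = ((-(3 * c' * alpha D ^ 2 * ell D) : ℝ) : ℂ) * I := by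
    unfold beta3 betaMain; push_cast; ring
  rw [h, norm_mul, Complex.norm_I, mul_one, Complex.norm_real, Real.norm_eq_abs, abs_neg, abs_mul,
    abs_mul, abs_mul, abs_of_nonneg hℓ, abs_of_nonneg (sq_nonneg (alpha D)),
    abs_of_nonneg (by norm_num : (0:ℝ) ≤ 3)]
  have h0 : 0 ≤ |c'| * alpha D ^ 2 * ell D := by positivity
  nlinarith

/-- `‖β_k⁰‖ = kα ≤ 3α` for `0 ≤ k ≤ 3` (`α ≥ 0`). [cite: Zhang2022LandauSiegel, §2 (2.13)] -/
theorem norm_betaMain_le {k : ℚ} (hk0 : 0 ≤ k) (hk : k ≤ 3) {α : ℝ} (hα : 0 ≤ α) :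
    ‖betaMain k α‖ ≤ 3 * α := by
  rw [norm_betaMain, abs_of_nonneg hα, abs_of_nonneg (by exact_mod_cast hk0)]
  gcongr
  exact_mod_cast hk

/-- `𝔣_{1μ}`, `𝔣_{2μ}`, `𝔣_{3μ}` unfolded (shift `β_j`). [cite: Zhang2022LandauSiegel, §8 Lemma 8.2] -/
theorem frakfW_one_two_three (μ : ℕ) (y : ℝ) :
    frakfW c' D 1 μ y = frakf (beta1 c' D) (betaMu D μ) (Real.log y) ∧
      frakfW c' D 2 μ y = frakf (beta2 c' D) (betaMu D μ) (Real.log y) ∧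
        frakfW c' D 3 μ y = frakf (beta3 c' D) (betaMu D μ) (Real.log y) := by
  refine ⟨?_, ?_, ?_⟩ <;> simp [frakfW, betaJ]

/-- `𝔤_{1μ}`, `𝔤_{2μ}`, `𝔤_{3μ}` unfolded: `(β_{j+1}, β_{j+2}) = (β₂,β₃), (β₃,β₁), (β₁,β₂)` (`β₄ = β₁`,
`β₅ = β₂`). [cite: Zhang2022LandauSiegel, §8 Lemma 8.4] -/
theorem frakgW_one_two_three (μ : ℕ) (y : ℝ) :
    frakgW c' D 1 μ y = frakg (beta2 c' D) (beta3 c' D) (betaMu D μ) (Real.log y) ∧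
      frakgW c' D 2 μ y = frakg (beta3 c' D) (beta1 c' D) (betaMu D μ) (Real.log y) ∧
        frakgW c' D 3 μ y = frakg (beta1 c' D) (beta2 c' D) (betaMu D μ) (Real.log y) := by
  refine ⟨?_, ?_, ?_⟩ <;> simp [frakgW, betaJ]

end Params

/-! ## The generic `O(𝓛⁻⁸)` bounds at `x = Pᶻ` -/

section Estimates

variable (c' : ℝ)

/-- `𝔣` at `x = Pᶻ`: `‖β − β_k⁰‖ ≤ wα` ⇒ `‖𝔣(β,β_μ; z log P) − 𝔣(β_k⁰,β_μ; z log P)‖ ≤ 5|c′|π²·𝓛⁻⁸`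
(`0 ≤ z ≤ 1`, `D ≥ 3`). [cite: Zhang2022LandauSiegel, §8 p.48] -/
theorem frakf_rpow_estimate {D : ℕ} (hD : 3 ≤ D) {β : ℂ} {k : ℚ}
    (hβ : ‖β - betaMain k (alpha D)‖ ≤ 5 * |c'| * alpha D * ell D * alpha D) (μ : ℚ) {z : ℝ}
    (hz0 : 0 ≤ z) (hz1 : z ≤ 1) :
    ‖frakf β (betaMain μ (alpha D)) ((z : ℂ) * ((ell D ^ 9 : ℝ) : ℂ)) -
        frakf (betaMain k (alpha D)) (betaMain μ (alpha D)) ((z : ℂ) * ((ell D ^ 9 : ℝ) : ℂ))‖ ≤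
      5 * |c'| * π ^ 2 * (ell D ^ 8)⁻¹ := by
  have hℓ : 0 ≤ ell D := by linarith [one_lt_ell' hD]
  have hα : 0 ≤ alpha D := (alpha_pos' hD).le
  have h9 : 0 ≤ ell D ^ 9 := pow_nonneg hℓ _
  have hw : 0 ≤ 5 * |c'| * alpha D * ell D * alpha D := by positivity
  rw [← Complex.ofReal_mul, norm_frakf_sub_frakf]
  have habs : |z * ell D ^ 9| ≤ ell D ^ 9 := by
    rw [abs_of_nonneg (mul_nonneg hz0 h9)]
    exact mul_le_of_le_one_left h9 hz1
  calc ‖β - betaMain k (alpha D)‖ * |z * ell D ^ 9|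
      ≤ 5 * |c'| * alpha D * ell D * alpha D * ell D ^ 9 := by gcongr
    _ = 5 * |c'| * (alpha D * ell D) * (alpha D * ell D ^ 9) := by ring
    _ = 5 * |c'| * π ^ 2 * (ell D ^ 8)⁻¹ := by
        rw [alpha_mul_ell hD, alpha_mul_ell_pow_nine hD]; ring

/-- `𝔤` at `x = Pᶻ`: `‖β₁ − β_{k₁}⁰‖, ‖β₂ − β_{k₂}⁰‖ ≤ wα` (`k₁, k₂ ∈ [0,3]`), `μ ∈ [3/2, 3]` ⇒
`‖𝔤(β₁,β₂,β_μ; z log P) − 𝔤(β_{k₁}⁰,β_{k₂}⁰,β_μ; z log P)‖ ≤ (70|c′|π² + 40c′²π³)·𝓛⁻⁸` (`0 ≤ z ≤ 1`,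
`D ≥ 3`). [cite: Zhang2022LandauSiegel, §8 p.49] -/
theorem frakg_rpow_estimate {D : ℕ} (hD : 3 ≤ D) {β1 β2 : ℂ} {k1 k2 : ℚ} (hk1 : 0 ≤ k1)
    (hk1' : k1 ≤ 3) (hk2 : 0 ≤ k2) (hk2' : k2 ≤ 3)
    (h1 : ‖β1 - betaMain k1 (alpha D)‖ ≤ 5 * |c'| * alpha D * ell D * alpha D)
    (h2 : ‖β2 - betaMain k2 (alpha D)‖ ≤ 5 * |c'| * alpha D * ell D * alpha D) {μ : ℚ}
    (hμ : 3 / 2 ≤ μ) (hμ' : μ ≤ 3) {z : ℝ} (hz0 : 0 ≤ z) (hz1 : z ≤ 1) :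
    ‖frakg β1 β2 (betaMain μ (alpha D)) ((z : ℂ) * ((ell D ^ 9 : ℝ) : ℂ)) -
        frakg (betaMain k1 (alpha D)) (betaMain k2 (alpha D)) (betaMain μ (alpha D))
          ((z : ℂ) * ((ell D ^ 9 : ℝ) : ℂ))‖ ≤
      (70 * |c'| * π ^ 2 + 40 * |c'| ^ 2 * π ^ 3) * (ell D ^ 8)⁻¹ := by
  have hℓ1 : 1 ≤ ell D := (one_lt_ell' hD).le
  have hℓ : 0 ≤ ell D := by linarith
  have hα : 0 < alpha D := alpha_pos' hD
  have h9 : 0 ≤ ell D ^ 9 := pow_nonneg hℓ _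
  have hw : 0 ≤ 5 * |c'| * alpha D * ell D := by positivity
  have hμ0 : 0 ≤ μ := le_trans (by norm_num) hμ
  have hμR : (3 : ℝ) / 2 ≤ (μ : ℝ) := by
    have h := (Rat.cast_le (K := ℝ)).mpr hμ
    push_cast at h
    exact h
  have hm : 3 / 2 * alpha D ≤ ‖betaMain μ (alpha D)‖ := by
    rw [norm_betaMain, abs_of_nonneg hα.le, abs_of_nonneg (by exact_mod_cast hμ0)]
    gcongr
  have hm' : ‖betaMain μ (alpha D)‖ ≤ 3 * alpha D := norm_betaMain_le hμ0 hμ' hα.le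
  have hL : alpha D * |z * ell D ^ 9| ≤ π := by
    rw [abs_of_nonneg (mul_nonneg hz0 h9), ← alpha_mul_ell_pow_nine hD]
    gcongr
    exact mul_le_of_le_one_left h9 hz1
  rw [← Complex.ofReal_mul]
  refine (norm_frakg_sub_frakg_le _ _ _ _ _ _ _).trans ?_
  refine (frakg_perturbation_bound hα hw h1 h2 (norm_betaMain_le hk1 hk1' hα.le)
    (norm_betaMain_le hk2 hk2' hα.le) hm hm' hL).trans ?_
  -- `(8/9)(6w + w²) + (2π/3)(12w + w²) ≤ (70|c′|π² + 40c′²π³)𝓛⁻⁸`, `w = 5|c′|π𝓛⁻⁸`, `𝓛⁻⁸ ≤ 1 ≤ π`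
  have hweq : 5 * |c'| * alpha D * ell D = 5 * |c'| * π * (ell D ^ 8)⁻¹ := by
    rw [mul_assoc (5 * |c'|), alpha_mul_ell hD]; ring
  rw [hweq]
  set t : ℝ := (ell D ^ 8)⁻¹ with ht
  have ht0 : 0 ≤ t := by rw [ht]; positivity
  have ht1 : t ≤ 1 := by rw [ht]; exact inv_le_one_of_one_le₀ (one_le_pow₀ hℓ1)
  have hπ1 : (1 : ℝ) ≤ π := by linarith [Real.pi_gt_three]
  have k1 : 0 ≤ |c'| ^ 2 * π ^ 2 * (t * (1 - t)) := by
    have : 0 ≤ 1 - t := by linarith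
    positivity
  have k2 : 0 ≤ π * (|c'| ^ 2 * π ^ 2 * (t * (1 - t))) := mul_nonneg Real.pi_pos.le k1
  have k3 : 0 ≤ |c'| * π * t * (π - 1) := by
    have : 0 ≤ π - 1 := by linarith
    positivity
  have k4 : 0 ≤ |c'| ^ 2 * π ^ 2 * t * (π - 1) := by
    have : 0 ≤ π - 1 := by linarith
    positivity
  nlinarith [k1, k2, k3, k4]

end Estimates

end Literature.NumberTheory.LFunctions.Zhang2022.Section8ShiftPerturbation
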